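import Literature.Probability.RandomPlanarGeometry.SAWFiniteMemorySymm
import HarnessLib

/-!
# `μ(ℤ²) ≤ 2.688`: the memory-18 Pönitz–Tittmann certificate at the printed `k = 18` value

Topic `Literature/Probability/RandomPlanarGeometry`. Companion of `SAWFiniteMemory18.lean`
(`connectiveConstant_le_2689`): the SAME symmetry-reduced memory-18 automaton of Pönitz–Tittmann
(2000) on `ℤ²` (`FiniteMemory.checkC`, `SAWFiniteMemorySymm.lean`: `336 168` normal forms of the
`2 689 301` states under the eight lattice symmetries, `80` rounds of integer power iteration, then
the verified Collatz–Wielandt check), evaluated once at the ratio `2688/1000` instead of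
`2689/1000`. Pönitz–Tittmann's Table 2 prints `μ ≤ 2.6880` for `k = 18`, so this file certifies the
printed four-digit value itself: **`μ(ℤ²) ≤ 2.688`**. The ratio `2688/1000` is the smallest
numerator accepted by the `80`-round weight vector (`2687/1000` fails the Collatz–Wielandt check
at some normal form); sharper printed values need more memory (`k = 20`: `2.6832`, ≈ `1.97 · 10⁶`
normal forms; record `k = 22` with state merging: `2.679192495`), beyond one kernel evaluation of
this checker.

The only non-standard axiom is the `native_decide` auxiliary axiom of `checkC_18_2688`
(`Lean.ofReduceBool`), declared to the gate as `computational`; the evaluation is the same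
breadth-first search and power iteration as `FiniteMemory.checkC_18` (≈ 5–7 minutes), which is
why it lives in its own file rather than being appended to `SAWFiniteMemory18.lean`.

## References

* A. Pönitz, P. Tittmann, *Improved upper bounds for self-avoiding walks in ℤᵈ*, Electron. J.
  Combin. 7 (2000) R21, §3 and Table 2 (`k = 18`: `2.6880`) [PonitzTittmann2000].
-/

namespace Literature.Probability.RandomPlanarGeometry.SAW

/-- The symmetry-reduced memory-18 certificate evaluates to `true` at ratio `2688/1000`
(`336 168` normal forms, `80` power-iteration rounds). [cite: PonitzTittmann2000, Table 2] -/
theorem FiniteMemory.checkC_18_2688 : FiniteMemory.checkC 18 2688 1000 80 = true := by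
  native_decide

/-- **`μ(ℤ²) ≤ 2.688`** — Pönitz–Tittmann 2000, Table 2, `k = 18`: `μ ≤ 2.6880`, the printed
value for memory 18. [cite: PonitzTittmann2000, Table 2] -/
theorem connectiveConstant_le_2688 : connectiveConstant ≤ 2.688 := by
  have h := FiniteMemory.connectiveConstant_le_of_checkC FiniteMemory.checkC_18_2688 (by norm_num)
  have e : ((2688 : ℕ) : ℝ) / ((1000 : ℕ) : ℝ) = 2.688 := by norm_num
  rwa [e] at h

/-- `μ(ℤ²) ≤ 2.688` in the `Zd` vocabulary (`Zd.connectiveConstant 2`), for users of the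
`d`-dimensional API. [cite: PonitzTittmann2000, Table 2] -/
theorem Zd.connectiveConstant_two_le_2688 : Zd.connectiveConstant 2 ≤ 2.688 := by
  rw [Zd.connectiveConstant_two]
  exact connectiveConstant_le_2688

end Literature.Probability.RandomPlanarGeometry.SAW
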